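import Summits.HodgeConjecture.HodgeConjecture.Theorems.Ring2WeilCoverageCMFieldCellsHodgeAtMember
import Summits.HodgeConjecture.HodgeConjecture.Theorems.Ring2WeilCoverageCMFieldCellsNonGalois
import Literature.AlgebraicGeometry.Deligne1982.WeilTypeCMFieldIsCM
import HarnessLib

/-!
# Ring 2 — Weil-type family-coverage census, CM-field rows (X-J): Deligne's carrier PRESENTS ITSELF —
# the table carrier `E = ℚ[T]/(R(T²))` with `b₀ = T` satisfies every presentation hypothesis of parts
# X-A … X-I, so the member-with-HC theorems hold ON THE TABLE'S OWN CARRIER `cmNormResidueGroup R`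

HONEST FRAMING: research route conditional on HC_CM; not a corollary; Q11.4-sentence-2 already refuted in dim ≥ 3.

Cell `pub-hodge-ring2`, seat `ring2-b03` (gen 56), census `WEIL-FAMILY-COVERAGE.md` «## b03» (CM fields `[E:ℚ] > 2`),
open cell (xi′) of b03.20: the uniform theorems of parts X-A … X-I (`Ring2WeilCoverageCMFieldCells*`) are stated for
an abstract CM number field `K` together with DELIGNE'S PRESENTATION — a purely imaginary `b₀ ∈ 𝓞_K` separating the
complex embeddings, `R ∈ ℤ[S]` monic with `R(T²) = minpoly_ℤ(b₀)` irreducible and all roots of `R` real negative —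
while the census TABLES b03.5–b03.18 (`Ring2WeilCoverageCMFieldZeta5`, `…TablesA/B/C`, `…RowsA–E`, `…AllPrimes*`)
live on Deligne's CARRIERS `cmField R = ℚ[T]/(R(T²))`, `realField R = ℚ[S]/(R)`, `cmNormResidueGroup R` for seven
explicit quadratic `R`. THIS FILE closes the gap between the two: for EVERY `R` (monic, `R(T²)` and `R` irreducible
over `ℚ`, roots of `R` real negative) the carrier `K := cmField R` with `b₀ := T mod R(T²)` (`cmRoot R`) satisfies
ALL the presentation hypotheses (§1), so every uniform theorem specialises to the table's own carrier (§2) with only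
the Galois-theoretic input left open (`IsGalois` / `IsCyclic` / an imaginary quadratic subfield / `¬ IsGalois`) — that
input is supplied for the seven census fields in the sequel parts X-K / X-L.

THEOREMS ONLY: no `def`, no named fact, no `sorry`. `HC_CM` (`Theses.RankFourFaces.CMAbelianHodge`) does not occur
in this file; the Hodge conjecture is used only where the tree PROVES it (Pohlmann / Hazama, through parts X-C / X-G).

* §1 `eval₂_int_cmRoot_comp_X_sq`, `isIntegral_int_cmRoot`, `ringHom_ext_cmRoot`, `comp_X_sq_eq_minpoly_int_cmRoot`,
  `carrier_presentation` — `b₀ = cmRoot R ∈ 𝓞_E` is purely imaginary (`complexConj b₀ = -b₀`, from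
  `Deligne1982.complexConj_apply_eq_cmConj`), separates the embeddings (`E = ℚ(b₀)`), `minpoly_ℤ(b₀) = R(T²)`
  (Gauss: `minpoly_ℚ = R(T²)` for the monic irreducible `R(T²)`, integrally closed `ℤ`), `[E:ℚ] = 2 deg R`.
* §2 carrier versions: `carrier_exists_cmMember_hasWeilDiscriminantCM` (X-A: every δ-cell of a GALOIS carrier has
  a CM member), `carrier_exists_cmEightfold_hodgeConjectureFor_of_isCyclic` (X-C: cyclic quartic carrier — a CM
  eightfold `B⁴`, `B` a simple CM surface, with HC in the kernel on EVERY row `δ ∈ cmNormResidueGroup R`),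
  `carrier_exists_cmEightfold_hodgeConjectureFor_of_quadratic_subfield` (X-C: quartic Galois carrier containing an
  imaginary quadratic field), `carrier_exists_cmEightfold_hodgeConjectureFor_of_not_isGalois` (X-G: non-Galois
  quartic carrier).

HONEST COLUMN: nothing is claimed at any member other than the named CM powers; the GENERAL member of every row stays
OPEN (deciding input = transport, crux stmt-1076); no positivity is recorded by `IsPolarizationClass` (parts X-D – X-I
treat the sign); the Galois-theoretic inputs are hypotheses here.

## References
* [Deligne1982HodgeCycles] P. Deligne (notes by J. S. Milne), *Hodge cycles on abelian varieties*, LNM 900 (1982),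
  §4 (the presentation `E = ℚ(η)`, `η̄ = -η`, `F = ℚ(η²)`; statement before Prop. 4.1) and §5 (c).
* [Pohlmann1968] H. Pohlmann, Ann. of Math. 88 (1968), Thm. 1. [Shimura1998] G. Shimura, *Abelian Varieties with
  Complex Multiplication and Modular Functions* (1998), §6.2 Thm. 3, §8 Ex. 8.4 (2).
-/

noncomputable section

set_option linter.dupNamespace false

namespace Summit.HodgeConjecture.HodgeConjecture.Ring2.WeilCoverageCM

open CategoryTheory CategoryTheory.Limits Polynomial NumberField
open Literature.AlgebraicGeometry Literature.AlgebraicGeometry.Motives Literature.AlgebraicGeometry.HodgeTheory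
open Literature.AlgebraicGeometry.ComplexMultiplication Literature.AlgebraicGeometry.Deligne1982
open Literature.AlgebraicGeometry.Milne1999
open Summit.HodgeConjecture.HodgeConjecture.Ring2.Hypotheses (RosatiCompatible)

/-! ## §1 Deligne's carrier presents itself -/

section Generic

variable {K : Type} [Field K] [NumberField K]

omit [NumberField K] in
/-- An element of a number field killed by a MONIC integer polynomial (through `ℤ → K`) is an algebraic integer:
it is the image of an element of `𝓞_K`. [folklore] -/
theorem exists_ringOfIntegers_coe_eq_of_eval₂_monic {x : K} {P : Polynomial ℤ} (hP : P.Monic)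
    (hx : Polynomial.eval₂ (Int.castRingHom K) x P = 0) : ∃ b : 𝓞 K, (b : K) = x := by
  have hint : IsIntegral ℤ x := ⟨P, hP, by rwa [algebraMap_int_eq]⟩
  exact ⟨⟨x, hint⟩, rfl⟩

/-- **`minpoly_ℤ` of an algebraic integer from a monic integer polynomial irreducible over `ℚ`** (Gauss's lemma /
`ℤ` integrally closed): if `P ∈ ℤ[T]` is monic, `P ⊗ ℚ` is irreducible and `P(b) = 0`, then `P = minpoly_ℤ(b)` for
`b ∈ 𝓞_K`, and `(P ⊗ ℚ)(b) = 0`. [folklore] -/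
theorem eq_minpoly_int_of_monic_of_irreducible_map (b : 𝓞 K) {P : Polynomial ℤ} (hP : P.Monic)
    (hirr : Irreducible (P.map (Int.castRingHom ℚ))) (hb : Polynomial.eval₂ (Int.castRingHom K) (b : K) P = 0) :
    P = minpoly ℤ b ∧ Polynomial.aeval (b : K) (P.map (Int.castRingHom ℚ)) = 0 := by
  have hintK : IsIntegral ℤ (b : K) := RingOfIntegers.isIntegral_coe b
  have heq : minpoly ℤ (b : K) = minpoly ℤ b := minpoly.algebraMap_eq (IsFractionRing.injective (𝓞 K) K) b
  have haev : Polynomial.aeval (b : K) (P.map (Int.castRingHom ℚ)) = 0 := by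
    rw [Polynomial.aeval_def, Polynomial.eval₂_map,
      show (algebraMap ℚ K).comp (Int.castRingHom ℚ) = Int.castRingHom K from RingHom.ext_int _ _]
    exact hb
  have hQ : P.map (Int.castRingHom ℚ) = minpoly ℚ (b : K) :=
    minpoly.eq_of_irreducible_of_monic hirr haev (hP.map _)
  refine ⟨?_, haev⟩
  rw [← heq]
  apply Polynomial.map_injective (Int.castRingHom ℚ) (Int.castRingHom ℚ).injective_int
  rw [hQ, minpoly.isIntegrallyClosed_eq_field_fractions' ℚ hintK, algebraMap_int_eq]

end Generic

section Polys

variable (R : Polynomial ℤ)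

/-- `R(T²)` is monic when `R` is. [folklore] -/
theorem monic_comp_X_sq (hRm : R.Monic) : (R.comp (X ^ 2)).Monic :=
  hRm.comp (Polynomial.monic_X_pow 2) (by rw [Polynomial.natDegree_X_pow]; norm_num)

/-- `deg R(T²) = 2 deg R` over `ℚ`. [folklore] -/
theorem natDegree_cmPolyQ_eq : (cmPolyQ R).natDegree = 2 * R.natDegree := by
  rw [cmPolyQ, Polynomial.natDegree_map_eq_of_injective (Int.castRingHom ℚ).injective_int,
    Polynomial.natDegree_comp, Polynomial.natDegree_X_pow, mul_comm]

end Polys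

section Presentation

variable (R : Polynomial ℤ) [Fact (Irreducible (cmPolyQ R))]

/-- `η = T mod R(T²)` is a root of `R(T²)` over `ℤ`: `R(T²)(η) = 0` in `E = ℚ[T]/(R(T²))`.
[cite: Deligne1982HodgeCycles, §4 p. 30] -/
theorem eval₂_int_cmRoot_comp_X_sq :
    Polynomial.eval₂ (Int.castRingHom (cmField R)) (cmRoot R) (R.comp (X ^ 2)) = 0 := by
  have h := AdjoinRoot.eval₂_root (cmPolyQ R)
  rw [cmPolyQ, Polynomial.eval₂_map] at h
  have e : (AdjoinRoot.of (cmPolyQ R)).comp (Int.castRingHom ℚ) = Int.castRingHom (cmField R) :=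
    RingHom.ext_int _ _
  rwa [e] at h

/-- An embedding `τ : E → S` evaluates classes of polynomials at `τ(η)`: `τ(p mod R(T²)) = p(τ(η))` (coefficients
through the unique `ℚ → S`). [folklore] -/
theorem ringHom_mk_eq_eval₂ {S : Type*} [CommRing S] (σ : cmField R →+* S) (p : Polynomial ℚ) :
    σ (AdjoinRoot.mk (cmPolyQ R) p) = Polynomial.eval₂ (σ.comp (AdjoinRoot.of (cmPolyQ R))) (σ (cmRoot R)) p := by
  rw [← AdjoinRoot.aeval_eq, Polynomial.aeval_def, AdjoinRoot.algebraMap_eq, Polynomial.hom_eval₂]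

/-- `E = ℚ(η)`: two ring homomorphisms out of `E` that agree at `η` are equal. [folklore] -/
theorem ringHom_ext_cmRoot {S : Type*} [CommRing S] {σ σ' : cmField R →+* S}
    (h : σ (cmRoot R) = σ' (cmRoot R)) : σ = σ' := by
  refine RingHom.ext fun x => ?_
  induction x using AdjoinRoot.induction_on with
  | ih p =>
    have hc : σ.comp (AdjoinRoot.of (cmPolyQ R)) = σ'.comp (AdjoinRoot.of (cmPolyQ R)) := RingHom.ext_rat _ _
    rw [ringHom_mk_eq_eval₂, ringHom_mk_eq_eval₂, hc, h]

/-- `η` separates the complex embeddings of `E`: `τ ↦ τ(η)` is injective. [cite: Deligne1982HodgeCycles, §4 p. 30] -/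
theorem injective_ringHom_apply_cmRoot :
    Function.Injective fun σ : cmField R →+* ℂ => σ (cmRoot R) :=
  fun _ _ h => ringHom_ext_cmRoot R h

/-- **Deligne's carrier presents itself.** For `R ∈ ℤ[S]` monic of degree `e₀` with `R(T²)` irreducible over `ℚ`
and all roots of `R` real negative, the carrier `E = cmField R = ℚ[T]/(R(T²))` (a CM field,
`Deligne1982.isCMField_cmField`) with `b₀ := η = T mod R(T²) ∈ 𝓞_E` satisfies every hypothesis of Deligne's
presentation used by parts X-A … X-I: `b̄₀ = -b₀`, `τ ↦ τ(b₀)` injective on the complex embeddings,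
`[E:ℚ] = 2e₀`, `minpoly_ℤ(b₀) = R(T²)` (Gauss), `R(T²)(b₀) = 0`, `deg R(T²) = [E:ℚ]`.
[cite: Deligne1982HodgeCycles, §4 p. 30 (`E = ℚ(η)`, `η̄ = -η`, `F = ℚ(η²)` totally real)] -/
theorem carrier_presentation (hRm : R.Monic) {e₀ : ℕ} (hRdeg : R.natDegree = e₀)
    (hroots : ∀ s : ℂ, Polynomial.eval₂ (Int.castRingHom ℂ) s R = 0 → s.im = 0 ∧ s.re < 0)
    [IsCMField (cmField R)] :
    ∃ b₀ : 𝓞 (cmField R), (b₀ : cmField R) = cmRoot R ∧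
      IsCMField.complexConj (cmField R) (b₀ : cmField R) = -(b₀ : cmField R) ∧
      (Function.Injective fun σ : cmField R →+* ℂ => σ (b₀ : cmField R)) ∧
      Module.finrank ℚ (cmField R) = 2 * e₀ ∧ R.comp (X ^ 2) = minpoly ℤ b₀ ∧
      Polynomial.aeval (b₀ : cmField R) (cmPolyQ R) = 0 ∧
      (cmPolyQ R).natDegree = Module.finrank ℚ (cmField R) := by
  obtain ⟨b₀, hb₀⟩ :=
    exists_ringOfIntegers_coe_eq_of_eval₂_monic (monic_comp_X_sq R hRm) (eval₂_int_cmRoot_comp_X_sq R)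
  have hmin := eq_minpoly_int_of_monic_of_irreducible_map b₀ (monic_comp_X_sq R hRm)
    (show Irreducible ((R.comp (X ^ 2)).map (Int.castRingHom ℚ)) from Fact.out)
    (by rw [hb₀]; exact eval₂_int_cmRoot_comp_X_sq R)
  refine ⟨b₀, hb₀, ?_, ?_, ?_, hmin.1, hmin.2, ?_⟩
  · rw [hb₀, complexConj_apply_eq_cmConj hroots, cmConj_cmRoot]
  · rw [hb₀]; exact injective_ringHom_apply_cmRoot R
  · rw [finrank_cmField, hRdeg]
  · rw [natDegree_cmPolyQ_eq, finrank_cmField]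

end Presentation

/-! ## §2 The uniform member theorems on the table's own carrier -/

section Carrier

variable (R : Polynomial ℤ) [Fact (Irreducible (cmPolyQ R))] [Fact (Irreducible (realPolyQ R))]

/-- **X-A on the carrier: every δ-cell of a GALOIS carrier has a CM member.** For `R` monic of degree
`e₀ ≥ 2` as above with `E = cmField R` Galois over `ℚ`, every `p ≥ 1` and EVERY `δ ∈ cmNormResidueGroup R`
(the table's own row index): a CM abelian variety with a Weil-type datum `IsWeilTypeCM A η R e₀ p`, a
Rosati-compatible polarization class and `disc = δ`. [cite: Deligne1982HodgeCycles, §5 (c) pp. 38–39] -/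
theorem carrier_exists_cmMember_hasWeilDiscriminantCM (hRm : R.Monic) {e₀ : ℕ} (hRdeg : R.natDegree = e₀)
    (he₀ : 2 ≤ e₀) (hroots : ∀ s : ℂ, Polynomial.eval₂ (Int.castRingHom ℂ) s R = 0 → s.im = 0 ∧ s.re < 0)
    [IsCMField (cmField R)] [IsGalois ℚ (cmField R)] {p : ℕ} (hp : 0 < p) (δ : cmNormResidueGroup R) :
    ∃ (A : AbelianVariety ℂ) (η : A ⟶ A) (h : complexBetti A.X 2),
      IsOfCMType A ∧ IsWeilTypeCM A η R e₀ p ∧ IsPolarizationClass A.dim A.X h ∧ RosatiCompatible A η h ∧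
        HasWeilDiscriminantCM A η R e₀ p h δ := by
  obtain ⟨b₀, -, hb₀, hsep, he, hR, haev, hdegQ⟩ := carrier_presentation R hRm hRdeg hroots
  exact exists_cmMember_hasWeilDiscriminantCM (cmField R) (by omega) hb₀ hsep he hRm hRdeg hR Fact.out hroots haev
    hdegQ hp δ

/-- **X-C on the carrier, CYCLIC quartic fields: HC at a CM eightfold on EVERY row of the table.** For `R` monic
QUADRATIC as above with `E = cmField R` Galois over `ℚ` with CYCLIC group, and EVERY `δ ∈ cmNormResidueGroup R`:
a CM eightfold `A ≅ B⁴`, `B` a SIMPLE CM abelian surface, with a Weil-type `(2,2;2,2)` datum, a Rosati-compatible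
polarization class of discriminant `δ`, the Hodge conjecture for `A` (kernel: Pohlmann, nondegenerate type —
Schappacher/Yanai supply) and `W_E(A) ⊗ ℂ` algebraic. [cite: Pohlmann1968, Thm. 1]
[cite: Deligne1982HodgeCycles, §5 (c) pp. 38–39] -/
theorem carrier_exists_cmEightfold_hodgeConjectureFor_of_isCyclic (hRm : R.Monic) (hRdeg : R.natDegree = 2)
    (hroots : ∀ s : ℂ, Polynomial.eval₂ (Int.castRingHom ℂ) s R = 0 → s.im = 0 ∧ s.re < 0)
    [IsCMField (cmField R)] [IsGalois ℚ (cmField R)] (hc : IsCyclic (cmField R ≃ₐ[ℚ] cmField R))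
    (δ : cmNormResidueGroup R) :
    ∃ (A : AbelianVariety ℂ) (η : A ⟶ A) (h : complexBetti A.X 2) (B : AbelianVariety ℂ),
      Nonempty (A ≅ ⨁ fun _ : Fin 4 => B) ∧ B.IsSimple ∧ B.dim = 2 ∧ IsOfCMType B ∧ A.dim = 8 ∧ IsOfCMType A ∧
      IsWeilTypeCM A η R 2 2 ∧ IsPolarizationClass A.dim A.X h ∧ RosatiCompatible A η h ∧
      HasWeilDiscriminantCM A η R 2 2 h δ ∧ HodgeConjectureFor A.dim A.X ∧
      weilClassesField A η (R.comp (X ^ 2)) (2 * 2) ≤ algebraicClasses A.X 2 := by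
  obtain ⟨b₀, -, hb₀, hsep, he, hR, haev, hdegQ⟩ := carrier_presentation R hRm hRdeg hroots
  exact exists_cmEightfold_hodgeConjectureFor_of_isCyclic_four (cmField R) hc (by omega) hb₀ hsep he hRm hRdeg hR
    Fact.out hroots haev hdegQ δ

/-- **X-C on the carrier, quartic fields with an IMAGINARY QUADRATIC subfield: HC at a CM eightfold on EVERY row.**
For `R` monic QUADRATIC as above with `E = cmField R` Galois over `ℚ`, a CM number field `K₁` of degree `2` with
`K₁ → E`, and EVERY `δ ∈ cmNormResidueGroup R`: a CM eightfold (`B⁴`, `B ~ C₁²` of induced type) with a Weil-type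
`(2,2;2,2)` datum, a Rosati-compatible polarization class of discriminant `δ`, the Hodge conjecture (kernel:
Hazama / Pohlmann, induced type) and `W_E ⊗ ℂ` algebraic. [cite: Gordon1999HodgeAVSurvey, Thm. 6.4]
[cite: Deligne1982HodgeCycles, §5 (c) pp. 38–39] -/
theorem carrier_exists_cmEightfold_hodgeConjectureFor_of_quadratic_subfield (hRm : R.Monic)
    (hRdeg : R.natDegree = 2)
    (hroots : ∀ s : ℂ, Polynomial.eval₂ (Int.castRingHom ℂ) s R = 0 → s.im = 0 ∧ s.re < 0)
    [IsCMField (cmField R)] [IsGalois ℚ (cmField R)]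
    {K₁ : Type} [Field K₁] [NumberField K₁] [IsCMField K₁] [Algebra K₁ (cmField R)]
    (h2 : Module.finrank ℚ K₁ = 2) (δ : cmNormResidueGroup R) :
    ∃ (A : AbelianVariety ℂ) (η : A ⟶ A) (h : complexBetti A.X 2),
      A.dim = 8 ∧ IsOfCMType A ∧ IsWeilTypeCM A η R 2 2 ∧ IsPolarizationClass A.dim A.X h ∧ RosatiCompatible A η h ∧
      HasWeilDiscriminantCM A η R 2 2 h δ ∧ HodgeConjectureFor A.dim A.X ∧
      weilClassesField A η (R.comp (X ^ 2)) (2 * 2) ≤ algebraicClasses A.X 2 := by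
  obtain ⟨b₀, -, hb₀, hsep, he, hR, haev, hdegQ⟩ := carrier_presentation R hRm hRdeg hroots
  exact exists_cmEightfold_hodgeConjectureFor_of_quadratic_subfield_four (cmField R) h2 (by omega) hb₀ hsep he hRm
    hRdeg hR Fact.out hroots haev hdegQ δ

/-- **X-G on the carrier, NON-GALOIS quartic fields: HC at a CM eightfold on EVERY row.** For `R` monic QUADRATIC as
above with `E = cmField R` NOT Galois over `ℚ` (the `D₄` case) and EVERY `δ ∈ cmNormResidueGroup R`: a CM eightfold
`B⁴` (`B` simple, primitive type by Schappacher, nondegenerate by Yanai) with a Weil-type `(2,2;2,2)` datum, a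
Rosati-compatible polarization class of discriminant `δ`, the Hodge conjecture (kernel) and `W_E ⊗ ℂ` algebraic.
[cite: Schmidt1984CMArithmetik, Kap. II Satz 1.6] [cite: Pohlmann1968, Thm. 1]
[cite: Deligne1982HodgeCycles, §5 (c) pp. 38–39] -/
theorem carrier_exists_cmEightfold_hodgeConjectureFor_of_not_isGalois (hRm : R.Monic) (hRdeg : R.natDegree = 2)
    (hroots : ∀ s : ℂ, Polynomial.eval₂ (Int.castRingHom ℂ) s R = 0 → s.im = 0 ∧ s.re < 0)
    [IsCMField (cmField R)] (hG : ¬ IsGalois ℚ (cmField R)) (δ : cmNormResidueGroup R) :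
    ∃ (A : AbelianVariety ℂ) (η : A ⟶ A) (h : complexBetti A.X 2),
      A.dim = 8 ∧ IsOfCMType A ∧ IsWeilTypeCM A η R 2 2 ∧ IsPolarizationClass A.dim A.X h ∧ RosatiCompatible A η h ∧
      HasWeilDiscriminantCM A η R 2 2 h δ ∧ HodgeConjectureFor A.dim A.X ∧
      weilClassesField A η (R.comp (X ^ 2)) (2 * 2) ≤ algebraicClasses A.X 2 := by
  obtain ⟨b₀, -, hb₀, hsep, he, hR, haev, hdegQ⟩ := carrier_presentation R hRm hRdeg hroots
  exact exists_cmEightfold_hodgeConjectureFor_of_not_isGalois_four (cmField R) hG (by omega) hb₀ hsep he hRm hRdeg hR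
    Fact.out hroots haev hdegQ δ

end Carrier

end Summit.HodgeConjecture.HodgeConjecture.Ring2.WeilCoverageCM

end
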